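import Literature.NumberTheory.LFunctions.SoundararajanTypicalOrdinates
import HarnessLib

/-!
# The ladder `V_n` of Soundararajan's contour (Balazard–de Roton 2008, §8.2)

Topic `Literature/NumberTheory/LFunctions`; a brick of the reduction of
`Literature.NumberTheory.LFunctions.BalazardDeRoton2010_thm1` to the engine statements of
Soundararajan's method (`SoundararajanTypicalOrdinates.lean`). M. Balazard, A. de Roton,
arXiv:0810.3587, §8.2 (identically arXiv:0812.1689, §6.2):

> Pour chaque `k` tel que `κ ≤ k < K`, on considère les entiers `n` de l'intervalle `[T_k, 2T_k[`.
> On définit alors `V_n` comme le plus petit entier de l'intervalle `[(log log T_k)², log T_k/log log T_k]`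
> tel que tous les points de `[n, n+1]` soient `V_n`-typiques de taille `T_k`. L'existence de `V_n`
> est garantie par la proposition 18. On a même `V_n ≤ ½ log n/log log n + log n (log log log n)/(log log n)² + 1`.

This file defines the admissibility predicate (`TypicalLadder.Admissible δ T n V`: `V` is an
integer in `[(log log T)², log T/log log T]` and every `t ∈ [n, n+1]` is `V`-typical of size `T`),
the ladder `TypicalLadder.ladder δ T n` = the least admissible integer (`Nat.find`; `0` if none), its
minimality (`ladder_le`, `not_admissible_ladder_sub_one`), and the existence of an admissible
integer from the conclusion of Proposition 18 (`TypicalLadder.Prop18With`, a predicate taken as a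
hypothesis): the integer `⌈(½ + log log log T/log log T)·log T/log log T⌉` is admissible for every
unit interval `[n, n+1] ⊆ [T, 2T]` once `T` is large (`admissible_ceil`), whence
`V_n ≤ (½ + log log log T/log log T) log T/log log T + 1` (`ladder_le_ceil`).

## References

* [BalazardRoton2008] M. Balazard, A. de Roton, arXiv:0810.3587, §8.2 (definition of `V_n`),
  Prop. 18.
-/

noncomputable section

open Real

namespace Literature.NumberTheory.LFunctions

namespace TypicalLadder

open Soundararajan

/-- `V` is *admissible* for the unit interval `[n, n+1]` at size `T`: `(log log T)² ≤ V ≤ log T/log log T`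
and every `t ∈ [n, n+1]` is a `V`-typical ordinate of size `T`. [cite: BalazardRoton2008, §8.2] -/
def Admissible (δ T : ℝ) (n V : ℕ) : Prop :=
  Real.log (Real.log T) ^ 2 ≤ V ∧ (V : ℝ) ≤ Real.log T / Real.log (Real.log T) ∧
    ∀ t : ℝ, (n : ℝ) ≤ t → t ≤ n + 1 → IsTypical δ T V t

open Classical in
/-- **The ladder `V_n`**: the least admissible integer for `[n, n+1]` at size `T` (and `0` if there
is none). [cite: BalazardRoton2008, §8.2] -/
def ladder (δ T : ℝ) (n : ℕ) : ℕ :=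
  if h : ∃ V : ℕ, Admissible δ T n V then Nat.find h else 0

/-- If some integer is admissible, `V_n` is admissible. [cite: BalazardRoton2008, §8.2] -/
theorem admissible_ladder {δ T : ℝ} {n : ℕ} (h : ∃ V : ℕ, Admissible δ T n V) :
    Admissible δ T n (ladder δ T n) := by
  classical
  rw [ladder, dif_pos h]
  exact Nat.find_spec h

/-- `V_n ≤ V` for every admissible `V`. [cite: BalazardRoton2008, §8.2] -/
theorem ladder_le {δ T : ℝ} {n V : ℕ} (hV : Admissible δ T n V) : ladder δ T n ≤ V := by
  classical
  have h : ∃ V : ℕ, Admissible δ T n V := ⟨V, hV⟩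
  rw [ladder, dif_pos h]
  exact Nat.find_min' h hV

/-- **Minimality**: `V_n − 1` is not admissible (when `V_n ≥ 1`). [cite: BalazardRoton2008, §8.4] -/
theorem not_admissible_ladder_sub_one {δ T : ℝ} {n : ℕ} (h : ∃ V : ℕ, Admissible δ T n V)
    (h1 : 1 ≤ ladder δ T n) : ¬Admissible δ T n (ladder δ T n - 1) := by
  classical
  rw [ladder, dif_pos h] at h1 ⊢
  exact Nat.find_min h (Nat.sub_one_lt_of_le h1 le_rfl)

/-- By minimality, if `V_n ≥ 1` and `V_n − 1` is still in the range `[(log log T)², log T/log log T]`,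
some point of `[n, n+1]` is `(V_n − 1)`-atypical of size `T`. [cite: BalazardRoton2008, §8.4] -/
theorem exists_not_typical {δ T : ℝ} {n : ℕ} (h : ∃ V : ℕ, Admissible δ T n V)
    (h1 : 1 ≤ ladder δ T n) (hlow : Real.log (Real.log T) ^ 2 ≤ ((ladder δ T n - 1 : ℕ) : ℝ)) :
    ∃ t : ℝ, (n : ℝ) ≤ t ∧ t ≤ n + 1 ∧ ¬IsTypical δ T ((ladder δ T n - 1 : ℕ) : ℝ) t := by
  have hna := not_admissible_ladder_sub_one h h1
  have hup : ((ladder δ T n - 1 : ℕ) : ℝ) ≤ Real.log T / Real.log (Real.log T) := by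
    have h2 := (admissible_ladder h).2.1
    have : ((ladder δ T n - 1 : ℕ) : ℝ) ≤ (ladder δ T n : ℝ) := by
      exact_mod_cast Nat.sub_le _ _
    exact this.trans h2
  by_contra hall
  push Not at hall
  exact hna ⟨hlow, hup, fun t ht1 ht2 ↦ hall t ht1 ht2⟩

/-! ## Existence from Proposition 18 -/

/-- The statement of Balazard–de Roton 2008, Proposition 18, for a fixed `δ` with threshold `T₀`
(the shape in which it is consumed; RH enters its proof through Goldston–Gonek).
[cite: BalazardRoton2008, Prop. 18] -/
def Prop18With (δ T₀ : ℝ) : Prop :=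
  ∀ T : ℝ, T₀ ≤ T → ∀ V : ℝ,
    1 / 2 + Real.log (Real.log (Real.log T)) / Real.log (Real.log T) ≤
        V * Real.log (Real.log T) / Real.log T →
    V * Real.log (Real.log T) / Real.log T ≤ 1 →
    ∀ t : ℝ, T ≤ t → t ≤ 2 * T → IsTypical δ T V t

/-- The integer `V*(T) = ⌈(½ + log log log T/log log T)·log T/log log T⌉`. [cite: BalazardRoton2008, §8.2] -/
def vStar (T : ℝ) : ℕ :=
  ⌈(1 / 2 + Real.log (Real.log (Real.log T)) / Real.log (Real.log T)) * Real.log T / Real.log (Real.log T)⌉₊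

/-- **Existence**: under the conclusion of Proposition 18 (`h18 : Prop18With δ T₀`), for `T ≥ T₀`
with `log T > 0`, `log log T > 0`, and the two largeness inequalities
`(log log T)² ≤ (½ + L₃/L₂) log T/log log T` and `(½ + L₃/L₂) log T/log log T + 1 ≤ log T/log log T`,
the integer `V*(T)` is admissible for every `[n, n+1] ⊆ [T, 2T]`. [cite: BalazardRoton2008, §8.2] -/
theorem admissible_vStar {δ T₀ T : ℝ} (h18 : Prop18With δ T₀) (hT : T₀ ≤ T)
    (hL : 0 < Real.log T) (hL₂ : 0 < Real.log (Real.log T))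
    (hbase : 0 ≤ 1 / 2 + Real.log (Real.log (Real.log T)) / Real.log (Real.log T))
    (ha : Real.log (Real.log T) ^ 2 ≤
      (1 / 2 + Real.log (Real.log (Real.log T)) / Real.log (Real.log T)) * Real.log T / Real.log (Real.log T))
    (hb : (1 / 2 + Real.log (Real.log (Real.log T)) / Real.log (Real.log T)) * Real.log T /
        Real.log (Real.log T) + 1 ≤ Real.log T / Real.log (Real.log T))
    {n : ℕ} (hn1 : T ≤ n) (hn2 : (n : ℝ) + 1 ≤ 2 * T) :
    Admissible δ T n (vStar T) := by
  set q : ℝ := (1 / 2 + Real.log (Real.log (Real.log T)) / Real.log (Real.log T)) * Real.log T /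
    Real.log (Real.log T) with hq
  have hq0 : 0 ≤ q := by rw [hq]; positivity
  have hceil1 : q ≤ (vStar T : ℝ) := Nat.le_ceil q
  have hceil2 : (vStar T : ℝ) < q + 1 := Nat.ceil_lt_add_one hq0
  refine ⟨ha.trans hceil1, by linarith, fun t ht1 ht2 ↦ ?_⟩
  refine h18 T hT (vStar T) ?_ ?_ t (hn1.trans ht1) (by linarith)
  · -- lower bound: `½ + L₃/L₂ ≤ V* L₂ / log T` from `q ≤ V*`
    have e : (1 / 2 + Real.log (Real.log (Real.log T)) / Real.log (Real.log T)) =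
        q * Real.log (Real.log T) / Real.log T := by
      rw [hq]; field_simp
    rw [e]
    exact div_le_div_of_nonneg_right (mul_le_mul_of_nonneg_right hceil1 hL₂.le) hL.le
  · -- upper bound: `V* L₂/log T ≤ 1` from `V* ≤ q + 1 ≤ log T/L₂`
    rw [div_le_one hL]
    have h1 : (vStar T : ℝ) ≤ Real.log T / Real.log (Real.log T) := by linarith
    have := mul_le_mul_of_nonneg_right h1 hL₂.le
    rwa [div_mul_cancel₀ _ hL₂.ne'] at this

/-- Hence, under the same hypotheses, `V_n` is admissible and `V_n ≤ V*(T) ≤ (½ + L₃/L₂) log T/log log T + 1`.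
[cite: BalazardRoton2008, §8.2] -/
theorem ladder_le_vStar {δ T₀ T : ℝ} (h18 : Prop18With δ T₀) (hT : T₀ ≤ T)
    (hL : 0 < Real.log T) (hL₂ : 0 < Real.log (Real.log T))
    (hbase : 0 ≤ 1 / 2 + Real.log (Real.log (Real.log T)) / Real.log (Real.log T))
    (ha : Real.log (Real.log T) ^ 2 ≤
      (1 / 2 + Real.log (Real.log (Real.log T)) / Real.log (Real.log T)) * Real.log T / Real.log (Real.log T))
    (hb : (1 / 2 + Real.log (Real.log (Real.log T)) / Real.log (Real.log T)) * Real.log T /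
        Real.log (Real.log T) + 1 ≤ Real.log T / Real.log (Real.log T))
    {n : ℕ} (hn1 : T ≤ n) (hn2 : (n : ℝ) + 1 ≤ 2 * T) :
    Admissible δ T n (ladder δ T n) ∧
      (ladder δ T n : ℝ) ≤ (1 / 2 + Real.log (Real.log (Real.log T)) / Real.log (Real.log T)) *
        Real.log T / Real.log (Real.log T) + 1 := by
  have hadm := admissible_vStar h18 hT hL hL₂ hbase ha hb hn1 hn2
  refine ⟨admissible_ladder ⟨_, hadm⟩, ?_⟩
  have h1 : (ladder δ T n : ℝ) ≤ (vStar T : ℝ) := by exact_mod_cast ladder_le hadm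
  have hq0 : 0 ≤ (1 / 2 + Real.log (Real.log (Real.log T)) / Real.log (Real.log T)) * Real.log T /
      Real.log (Real.log T) := by positivity
  have h2 : (vStar T : ℝ) < _ := Nat.ceil_lt_add_one hq0
  exact h1.trans h2.le

end TypicalLadder

end Literature.NumberTheory.LFunctions

end
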